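import Summits.QuantumFields.YangMills.Theorems.BalabanUVNodesN06Thm312313ParLawsQStar
import Literature.MathematicalPhysics.QuantumFieldTheory.Balaban1983to89.B9SectBQLawsL2OfKernelY
import Literature.MathematicalPhysics.QuantumFieldTheory.Balaban1983to89.B6Prop27KLevelV1

/-!
# Balaban UV-stability nodes, N06 [B9] Sect. B — «K2-G-L1»: THE KNIT KERNEL DATA for the displayed size laws `hQ15 ∕ hQL2` of the K2-G frames, at print's
# averaging pair `(Q(U), Q*(U)) = (QknitY i U, adjTrY (QknitY i U))` ([B8] Prop. 2) on the small-field class (3.35), `𝔸 = M_N(ℂ)`, `G ≤ U(N)`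

[B9] = T. Bałaban, *Propagators for lattice gauge theories in a background field*, Commun. Math. Phys. **99** (1985) 389–434
[`Balaban1985BackgroundPropagators`]; [4] = [`Balaban1984PropagatorsII`]; [B8] = [`Balaban1985Averaging`].

statement-level skeleton of published theorems with citation tags; proofs where landed; nothing here is a claim about the Yang–Mills mass gap

WHAT (seat dag-n06-c gen 25; dag-n06-l I.20442 «please type it»).  `Literature/…/B9SectBQLawsL2OfKernelY.hQ15_of_kernels' ∕ hQL2_of_kernels` reduce the K2-G
binders `hQ15 ∕ hQL2` to KERNEL DATA per member and configuration: nonnegative kernels majorising the rows of `𝔮 U` and the columns of `𝔮s U`, row mass,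
BLOCK-RESTRICTED volume-weighted column mass, support radius.  THIS FILE supplies that data at the knit pair from dag-n06-l's kernel theorems:
§1 the kernel `k_knit(κ,f) = q_κ(f) + K_col·α₀′·boxK κ f` — nonnegativity, row mass (`sum_knitRow_le`), support radius `ℓ + 4` in the labelled blocks
`ιB ∘ blkV1` (`dist_le_of_knitRow_ne_zero_bI` at the 0-faithful section `ιB ∘ blkV1` + def-Y's `geo9K_dist_lab_repBondY_self`), and the block-restricted
volume-weighted column mass `≦ 2(d+1)·(1 + K_col α₀′)` (`knitRow_le_plateau` × the carrier-fibre count `B6Prop27KLevelV1.card_fiber_beta_le`, pointed to by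
dag-n06-l, cell INBOX 2026-08-30 20:40Z); §2 ★★ `knit_kernel_data_of_reg335P` — on `(bg9KP M_N(ℂ) G i).Reg335 c₀ α₀ U`
with dag-n06-l's x-free numerics, the 10-tuple of kernel facts for `(QknitY i U, adjTrY (QknitY i U))` with kernels `(k_knit, N⁴·k_knit)` (`norm_QknitY_apply_le_sum_knitRow`,
`norm_adjTrY_apply_le_of_rowKernel`), masses `≦ C_knit := N⁴·(1 + 2(d+1))·(1 + K_col α₀′·2(d+1))`, radius `ℓ + 4` — EXACTLY the per-`(j, U)` conjunct of the `hker`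
hypotheses of `hQ15_of_kernels'` and `hQL2_of_kernels` (both support keys supplied: `blkC ιB ∘ boxEquiv ∘ src` and `ιB ∘ blkV1`, equal by `rfl`).

HONEST SCOPE.  Bookkeeping over dag-n06-l's kernel theorems; the (3.35) regime is a HYPOTHESIS; count-neutral; N06 NOT discharged; K1⁹ NOT
closed; nothing continuum ∕ OS ∕ mass-gap ∕ Clay.  0 `def`, 0 `sorry`.  `--supports stmt-QuantumFields-27364`.
-/

noncomputable section

namespace Summit.QuantumFields.YangMills.BalabanUVNodes.N06SectBQLawsKnit

open scoped Matrix Matrix.Norms.L2Operator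
open Literature.MathematicalPhysics.QuantumFieldTheory.Balaban1983to89
open Literature.MathematicalPhysics.QuantumFieldTheory.Balaban1983to89.Node00 (SiteY BlkY FBondY IBondY CfgY repBondY bondCoordsY)
open Literature.MathematicalPhysics.QuantumFieldTheory.Balaban1983to89.Node00.OpsYQLetter (adjTrY)
open Literature.MathematicalPhysics.QuantumFieldTheory.Balaban1983to89.B6Ineq2142KLevelV1 (lvl β qwt qwt_nonneg)
open Literature.MathematicalPhysics.QuantumFieldTheory.Balaban1983to89.B6GlobalChartV1 (blkV1 boxEquiv)
open Literature.MathematicalPhysics.QuantumFieldTheory.Balaban1983to89.B6Geom246MultiLevelTorus (geomT bondT)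
open Literature.MathematicalPhysics.QuantumFieldTheory.Balaban1983to89.B6KLevelCensusIndexV1 (KIdx kGeo)
open Literature.MathematicalPhysics.QuantumFieldTheory.Balaban1983to89.B9GeoNormsKLevelV1 (geo9K)
open Literature.MathematicalPhysics.QuantumFieldTheory.Balaban1983to89.B9GeoLemma21KLevelV1 (geo9K_dist_comm geo9K_dist_triangle one_le_k)
open Literature.MathematicalPhysics.QuantumFieldTheory.Balaban1983to89.B6Prop27KLevelV1 (card_fiber_beta_le)
open Literature.MathematicalPhysics.QuantumFieldTheory.Balaban1983to89.B9BackgroundsKLevelV1P (bg9KP)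
open Literature.MathematicalPhysics.QuantumFieldTheory.Balaban1983to89.B9Eq360DeltaPrimeAY (blkY)
open Literature.MathematicalPhysics.QuantumFieldTheory.Balaban1983to89.B9SectBGpLettersY (blkC)
open Literature.MathematicalPhysics.QuantumFieldTheory.Balaban1983to89.B9SectBGWordDeltaAY (volY volY_pos)
open Literature.MathematicalPhysics.QuantumFieldTheory.Balaban1983to89.B9SectBL2GReadY (indB indB_nonneg_le_one)
open Literature.MathematicalPhysics.QuantumFieldTheory.Balaban1983to89.B9SectBQLettersL2Y (indB_of_eq indB_of_ne)
open Literature.MathematicalPhysics.QuantumFieldTheory.Balaban1983to89.B7Prop2Explicit (unitaryUnits)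
open Literature.MathematicalPhysics.QuantumFieldTheory.Balaban1983to89.B9Eq316AveragingTransposeZd (alphaQ)
open Literature.MathematicalPhysics.QuantumFieldTheory.Balaban1983to89.B9Eq3115KnitLetterY (QknitY)
open Literature.MathematicalPhysics.QuantumFieldTheory.Balaban1983to89.B9Eq3115KnitLetterYRowCloseness (boxK boxK_nonneg)
open Literature.MathematicalPhysics.QuantumFieldTheory.Balaban1983to89.B9C2FormBoxRegimeY (Kpl)
open Literature.MathematicalPhysics.QuantumFieldTheory.Balaban1983to89.B9Eq3115KnitLetterYOnto (kCol kCol_nonneg)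
open Summit.QuantumFields.YangMills.BalabanUVNodes.N06Thm312313ParLawsQRow (norm_QknitY_apply_le_sum_knitRow sum_knitRow_le dist_le_of_knitRow_ne_zero_bI)
open Summit.QuantumFields.YangMills.BalabanUVNodes.N06Thm312313ParLawsQStar (norm_adjTrY_apply_le_of_rowKernel knitRow_le_plateau)

variable {d ℓ : ℕ} {hd : 1 ≤ d + 1} {hL : Odd (ℓ + 1) ∧ 1 < ℓ + 1} {b₀ b₁ : ℝ}
variable (i : KIdx d ℓ hd hL b₀ b₁) (ιB : BlkY i → IBondY i)

/-! ## §1 The knit kernel `k_knit = q + K_col·α₀′·boxK`: sign, support in the labelled blocks, block-restricted volume-weighted column mass -/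

/-- `k_knit ≥ 0`. [cite: Balaban1984PropagatorsI, (1.18) p.20; Balaban1985Averaging, (139) p.39] -/
theorem knitRow_nonneg {α₀' : ℝ} (hα : 0 ≤ α₀') (κ : IBondY i) (f : FBondY i) :
    0 ≤ qwt i.hN i.D i.hk κ f + kCol (d + 1) (ℓ + 1) * α₀' * boxK i κ f :=
  add_nonneg (qwt_nonneg i.hN i.D i.hk κ f) (mul_nonneg (mul_nonneg (kCol_nonneg _ _) hα) (boxK_nonneg i κ f))

/-- the section `ιB ∘ blkV1` is 0-faithful: `dist(β(ιB(blkV1 f)), blkV1 f) = 0 ≤ 1`. [cite: Balaban1984PropagatorsII, (2.45) p.231, bookkeeping] -/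
theorem hβ1_blkV1 (hι : ∀ s : BlkY i, β i.hN i.D i.hk (ιB s) = s) (f : FBondY i) :
    (geomT i.D).dist (β i.hN i.D i.hk (ιB (blkV1 i.hN i.D f))) (blkV1 i.hN i.D f) ≤ 1 := by
  rw [hι]
  show (((bondT i.D).dist (blkV1 i.hN i.D f) (blkV1 i.hN i.D f) : ℕ) : ℝ) ≤ 1
  rw [SimpleGraph.dist_self, Nat.cast_zero]; exact zero_le_one

/-- ★ **SUPPORT OF THE KNIT KERNEL IN THE LABELLED BLOCKS**: `k_knit(κ,f) ≠ 0 ⟹ dist(ιB(blkV1(rep κ)), ιB(blkV1 f)) ≦ ℓ + 4` — dag-n06-l's `dist_le_of_knitRow_ne_zero_bI`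
at the 0-faithful section `ιB ∘ blkV1`, moved from `κ` to its representative's labelled block (distance `0`, def-Y's `geo9K_dist_lab_repBondY_self`).
[cite: Balaban1984PropagatorsII, (2.45)–(2.46) p.231; Balaban1985Averaging, p.24 (locality)] -/
theorem knitRow_supp_blkV1 (hι : ∀ s : BlkY i, β i.hN i.D i.hk (ιB s) = s) {α₀' : ℝ} {κ : IBondY i} {f : FBondY i}
    (h : qwt i.hN i.D i.hk κ f + kCol (d + 1) (ℓ + 1) * α₀' * boxK i κ f ≠ 0) :
    (geo9K i).dist (ιB (blkV1 i.hN i.D (repBondY i κ))) (ιB (blkV1 i.hN i.D f)) ≤ (ℓ : ℝ) + 4 := by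
  have h1 : (geo9K i).dist κ (ιB (blkV1 i.hN i.D f)) ≤ (ℓ : ℝ) + 4 :=
    dist_le_of_knitRow_ne_zero_bI i (bI := fun f => ιB (blkV1 i.hN i.D f)) (hβ1_blkV1 i ιB hι) h
  have h0 : (geo9K i).dist (ιB (blkV1 i.hN i.D (repBondY i κ))) κ = 0 := by
    rw [geo9K_dist_comm]
    exact Node00.geo9K_dist_lab_repBondY_self i ιB hι κ
  linarith [geo9K_dist_triangle i (ιB (blkV1 i.hN i.D (repBondY i κ))) κ (ιB (blkV1 i.hN i.D f))]

/-- the same support law keyed by the coordinates' block map `blkC ιB ∘ boxEquiv ∘ src` (equal to `ιB ∘ blkV1` by `rfl`). [cite: Balaban1984PropagatorsII, (2.45)–(2.46) p.231] -/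
theorem knitRow_supp_blkC (hι : ∀ s : BlkY i, β i.hN i.D i.hk (ιB s) = s) {α₀' : ℝ} {κ : IBondY i} {f : FBondY i}
    (h : qwt i.hN i.D i.hk κ f + kCol (d + 1) (ℓ + 1) * α₀' * boxK i κ f ≠ 0) :
    (geo9K i).dist (blkC i ιB (boxEquiv i.hN (repBondY i κ).src)) (blkC i ιB (boxEquiv i.hN f.src)) ≤ (ℓ : ℝ) + 4 :=
  knitRow_supp_blkV1 i ιB hι h

/-- ★ **THE PLATEAU AGAINST THE VOLUME**: `vol(κ)·k_knit(κ,f) ≦ 1 + K_col·α₀′` (dag-n06-l's `knitRow_le_plateau`, `vol(κ) = (L^{d+1})^{j(κ)}`).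
[cite: Balaban1984PropagatorsI, (1.18) p.20; Balaban1985Averaging, (139) p.39] -/
theorem vol_mul_knitRow_le {α₀' : ℝ} (hα : 0 ≤ α₀') (κ : IBondY i) (f : FBondY i) :
    volY i κ * (qwt i.hN i.D i.hk κ f + kCol (d + 1) (ℓ + 1) * α₀' * boxK i κ f) ≤ 1 + kCol (d + 1) (ℓ + 1) * α₀' := by
  have h := mul_le_mul_of_nonneg_left (knitRow_le_plateau i hα κ f) (volY_pos i κ).le
  refine h.trans (le_of_eq ?_)
  have hv : (0 : ℝ) < volY i κ := volY_pos i κ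
  show volY i κ * ((1 + kCol (d + 1) (ℓ + 1) * α₀') * (volY i κ)⁻¹) = _
  rw [mul_comm (1 + _) _, ← mul_assoc, mul_inv_cancel₀ hv.ne', one_mul]

/-- ★ **THE BLOCK-RESTRICTED VOLUME-WEIGHTED COLUMN MASS OF THE KNIT KERNEL**: `Σ_κ 1_{y}(rep κ)·vol(κ)·k_knit(κ,f) ≦ 2(d+1)·(1 + K_col α₀′)` — the summands
live on the carrier fibre `{κ : β κ = β y}` (`blkV1 (rep κ) = β κ`, def-Y's `blkY_repBondY_src`) of cardinality `≦ 2(d+1)` (r03's `B6Prop27KLevelV1.card_fiber_beta_le`,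
pointed to by dag-n06-l) and each is `≦ 1 + K_col α₀′`. [cite: Balaban1984PropagatorsII, (2.3) p.224, (2.45) p.231; Balaban1985Averaging, (139) p.39] -/
theorem sum_indB_vol_knitRow_le (hι : ∀ s : BlkY i, β i.hN i.D i.hk (ιB s) = s)
    {α₀' : ℝ} (hα : 0 ≤ α₀') (f : FBondY i) (y : IBondY i) :
    ∑ κ, indB i ιB y (repBondY i κ) * (volY i κ * (qwt i.hN i.D i.hk κ f + kCol (d + 1) (ℓ + 1) * α₀' * boxK i κ f))
      ≤ (2 * ((d : ℝ) + 1)) * (1 + kCol (d + 1) (ℓ + 1) * α₀') := by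
  classical
  set K1 : ℝ := 1 + kCol (d + 1) (ℓ + 1) * α₀' with hK1
  have hK1' : 0 ≤ K1 := by rw [hK1]; exact add_nonneg zero_le_one (mul_nonneg (kCol_nonneg _ _) hα)
  set F := Finset.univ.filter fun κ : IBondY i => β i.hN i.D i.hk κ = β i.hN i.D i.hk y with hF
  -- the summand vanishes off `F` and is `≤ K1` on `F`
  have hterm : ∀ κ, indB i ιB y (repBondY i κ) * (volY i κ * (qwt i.hN i.D i.hk κ f + kCol (d + 1) (ℓ + 1) * α₀' * boxK i κ f))
      ≤ if κ ∈ F then K1 else 0 := by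
    intro κ
    by_cases hy : ιB (blkV1 i.hN i.D (repBondY i κ)) = y
    · have hmem : κ ∈ F := by
        rw [hF, Finset.mem_filter]
        refine ⟨Finset.mem_univ _, ?_⟩
        have hb : blkV1 i.hN i.D (repBondY i κ) = β i.hN i.D i.hk κ := Node00.blkY_repBondY_src i κ
        rw [← hy, hb, hι]
      rw [if_pos hmem, indB_of_eq i ιB hy, one_mul]
      exact vol_mul_knitRow_le i hα κ f
    · rw [indB_of_ne i ιB hy, zero_mul]
      split_ifs
      · exact hK1'
      · exact le_rfl
  calc ∑ κ, indB i ιB y (repBondY i κ) * (volY i κ * (qwt i.hN i.D i.hk κ f + kCol (d + 1) (ℓ + 1) * α₀' * boxK i κ f))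
      ≤ ∑ κ, (if κ ∈ F then K1 else 0) := Finset.sum_le_sum fun κ _ => hterm κ
    _ = (F.card : ℝ) * K1 := by rw [Finset.sum_ite_mem, Finset.univ_inter, Finset.sum_const, nsmul_eq_mul]
    _ ≤ (2 * ((d : ℝ) + 1)) * K1 := mul_le_mul_of_nonneg_right (by exact_mod_cast card_fiber_beta_le i.hN i.D i.hk (one_le_k i) _) hK1'

/-! ## §2 ★★ The kernel data of the knit pair on (3.35) — the per-`(j, U)` conjunct of `hQ15_of_kernels'` ∕ `hQL2_of_kernels` -/

section Reg

variable {N : ℕ} [Nonempty (Fin N)]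

/-- ★★ **THE KNIT KERNEL DATA ON THE SMALL-FIELD CLASS (3.35)**: for `G ≤ U(N)`, `U` in `(bg9KP M_N(ℂ) G i).Reg335 c₀ α₀` (`c₀ ≦ 10`, `0 ≦ Mα₀`), x-free numerics
`0 < α₀′ ≦ α_Q`, `K_pl(Mα₀)·L⁴ < α₀′` and a β-section `ιB`: the pair `(QknitY i U, adjTrY (QknitY i U))` is majorised by the
kernels `(k_knit, N⁴·k_knit)` — rows of `Q(U)` (dag-n06-l's `norm_QknitY_apply_le_sum_knitRow`), columns of `Q*(U)` (`norm_adjTrY_apply_le_of_rowKernel`), both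
kernels with row mass and block-restricted volume-weighted column mass `≦ C_knit = N⁴·(1 + 2(d+1))·(1 + K_col α₀′·2(d+1))` and support radius `ℓ + 4` (both keys).
[cite: Balaban1985BackgroundPropagators, (3.12)–(3.15) pp.392–393, (3.35) p.396; Balaban1985Averaging, Prop. 2 p.26, (139)–(147) pp.39–40; Balaban1984PropagatorsII, (2.45)–(2.46) p.231] -/
theorem knit_kernel_data_of_reg335P {G : Subgroup (Matrix (Fin N) (Fin N) ℂ)ˣ} (hGU : G ≤ unitaryUnits (Matrix (Fin N) (Fin N) ℂ))
    (hι : ∀ s : BlkY i, β i.hN i.D i.hk (ιB s) = s)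
    {U : CfgY (Matrix (Fin N) (Fin N) ℂ) i} {c₀ α₀ : ℝ} (hc : c₀ ≤ 10) (hMα : 0 ≤ (kGeo i).M * α₀)
    (hreg : (bg9KP (Matrix (Fin N) (Fin N) ℂ) G i).Reg335 c₀ α₀ U) {α₀' : ℝ} (hα' : 0 < α₀') (hαQ : α₀' ≤ alphaQ (d + 1) (ℓ + 1))
    (hK : Kpl i ((kGeo i).M * α₀) * (kGeo i).L ^ 4 < α₀') :
    let k : IBondY i → FBondY i → ℝ := fun κ f => qwt i.hN i.D i.hk κ f + kCol (d + 1) (ℓ + 1) * α₀' * boxK i κ f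
    let ks : IBondY i → FBondY i → ℝ := fun κ f => (N : ℝ) ^ 4 * k κ f
    let C : ℝ := (N : ℝ) ^ 4 * ((1 + 2 * ((d : ℝ) + 1)) * (1 + kCol (d + 1) (ℓ + 1) * α₀' * (2 * ((d : ℝ) + 1))))
    (∀ κ f, 0 ≤ k κ f) ∧ (∀ (Λ : FBondY i → Matrix (Fin N) (Fin N) ℂ) κ, ‖QknitY i U Λ κ‖ ≤ ∑ f, k κ f * ‖Λ f‖) ∧
      (∀ κ, ∑ f, k κ f ≤ C) ∧ (∀ f (y : IBondY i), ∑ κ, indB i ιB y (repBondY i κ) * (volY i κ * k κ f) ≤ C) ∧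
      (∀ κ f, k κ f ≠ 0 → (geo9K i).dist (ιB (blkV1 i.hN i.D (repBondY i κ))) (ιB (blkV1 i.hN i.D f)) ≤ (ℓ : ℝ) + 4) ∧
    (∀ κ f, 0 ≤ ks κ f) ∧ (∀ (Ψ : IBondY i → Matrix (Fin N) (Fin N) ℂ) f, ‖adjTrY (QknitY i U) Ψ f‖ ≤ ∑ κ, ks κ f * ‖Ψ κ‖) ∧
      (∀ κ, ∑ f, ks κ f ≤ C) ∧ (∀ f (y : IBondY i), ∑ κ, indB i ιB y (repBondY i κ) * (volY i κ * ks κ f) ≤ C) ∧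
      (∀ κ f, ks κ f ≠ 0 → (geo9K i).dist (ιB (blkV1 i.hN i.D (repBondY i κ))) (ιB (blkV1 i.hN i.D f)) ≤ (ℓ : ℝ) + 4) := by
  intro k ks C
  have hk0 : ∀ κ f, 0 ≤ k κ f := fun κ f => knitRow_nonneg i hα'.le κ f
  have hN1 : (1 : ℝ) ≤ (N : ℝ) ^ 4 := one_le_pow₀ (by exact_mod_cast Nat.one_le_iff_ne_zero.2 (Fin.pos_iff_nonempty.2 ‹Nonempty (Fin N)›).ne')
  have hKc : 0 ≤ kCol (d + 1) (ℓ + 1) * α₀' := mul_nonneg (kCol_nonneg _ _) hα'.le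
  set R₁ : ℝ := 1 + kCol (d + 1) (ℓ + 1) * α₀' * (2 * ((d : ℝ) + 1)) with hR₁
  set K1 : ℝ := 1 + kCol (d + 1) (ℓ + 1) * α₀' with hK1
  have hK1R : K1 ≤ R₁ := by
    rw [hK1, hR₁]
    have hd1 : (1 : ℝ) ≤ 2 * ((d : ℝ) + 1) := by have := (Nat.cast_nonneg d : (0:ℝ) ≤ d); linarith
    nlinarith
  have hR₁0 : 0 ≤ R₁ := by rw [hR₁]; positivity
  set n₀ : ℝ := 2 * ((d : ℝ) + 1) with hn₀
  have hn00 : 0 ≤ n₀ := by rw [hn₀]; positivity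
  have hn0 : (1 : ℝ) ≤ 1 + n₀ := by linarith
  -- the four masses against `C`
  have hrowC : R₁ ≤ C := by
    calc R₁ = 1 * (1 * R₁) := by ring
      _ ≤ (N : ℝ) ^ 4 * ((1 + n₀) * R₁) := by gcongr
  have hcolC : n₀ * K1 ≤ C := by
    calc n₀ * K1 ≤ (1 + n₀) * R₁ := by
          refine mul_le_mul (by linarith) hK1R (by rw [hK1]; positivity) (by positivity)
      _ = 1 * ((1 + n₀) * R₁) := (one_mul _).symm
      _ ≤ (N : ℝ) ^ 4 * ((1 + n₀) * R₁) := by gcongr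
  have hrowCs : (N : ℝ) ^ 4 * R₁ ≤ C := by
    show (N : ℝ) ^ 4 * R₁ ≤ (N : ℝ) ^ 4 * ((1 + n₀) * R₁)
    refine mul_le_mul_of_nonneg_left ?_ (by positivity)
    calc R₁ = 1 * R₁ := (one_mul _).symm
      _ ≤ (1 + n₀) * R₁ := by gcongr
  have hcolCs : (N : ℝ) ^ 4 * ((n₀ : ℝ) * K1) ≤ C := by
    show (N : ℝ) ^ 4 * ((n₀ : ℝ) * K1) ≤ (N : ℝ) ^ 4 * ((1 + n₀) * R₁)
    refine mul_le_mul_of_nonneg_left ?_ (by positivity)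
    exact mul_le_mul (by linarith) hK1R (by rw [hK1]; positivity) (by positivity)
  -- the data
  have hrow : ∀ (Λ : FBondY i → Matrix (Fin N) (Fin N) ℂ) κ, ‖QknitY i U Λ κ‖ ≤ ∑ f, k κ f * ‖Λ f‖ :=
    fun Λ κ => norm_QknitY_apply_le_sum_knitRow i hGU hc hMα hreg hα' hαQ hK Λ κ
  have hsum : ∀ κ, ∑ f, k κ f ≤ R₁ := fun κ => sum_knitRow_le i hα'.le κ
  have hsumV : ∀ f (y : IBondY i), ∑ κ, indB i ιB y (repBondY i κ) * (volY i κ * k κ f) ≤ n₀ * K1 :=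
    fun f y => sum_indB_vol_knitRow_le i ιB hι hα'.le f y
  have hsupp : ∀ κ f, k κ f ≠ 0 → (geo9K i).dist (ιB (blkV1 i.hN i.D (repBondY i κ))) (ιB (blkV1 i.hN i.D f)) ≤ (ℓ : ℝ) + 4 :=
    fun κ f h => knitRow_supp_blkV1 i ιB hι h
  have hcol : ∀ (Ψ : IBondY i → Matrix (Fin N) (Fin N) ℂ) f, ‖adjTrY (QknitY i U) Ψ f‖ ≤ ∑ κ, ks κ f * ‖Ψ κ‖ := by
    intro Ψ f
    refine (norm_adjTrY_apply_le_of_rowKernel i (QknitY i U) k hk0 hrow Ψ f).trans (le_of_eq ?_)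
    rw [Finset.mul_sum]
    exact Finset.sum_congr rfl fun κ _ => by ring
  refine ⟨hk0, hrow, fun κ => (hsum κ).trans hrowC, fun f y => (hsumV f y).trans hcolC, hsupp,
    fun κ f => mul_nonneg (by positivity) (hk0 κ f), hcol, fun κ => ?_, fun f y => ?_, fun κ f h => hsupp κ f ?_⟩
  · calc ∑ f, ks κ f = (N : ℝ) ^ 4 * ∑ f, k κ f := by rw [Finset.mul_sum]
      _ ≤ (N : ℝ) ^ 4 * R₁ := mul_le_mul_of_nonneg_left (hsum κ) (by positivity)
      _ ≤ C := hrowCs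
  · calc ∑ κ, indB i ιB y (repBondY i κ) * (volY i κ * ks κ f)
        = (N : ℝ) ^ 4 * ∑ κ, indB i ιB y (repBondY i κ) * (volY i κ * k κ f) := by
          rw [Finset.mul_sum]; exact Finset.sum_congr rfl fun κ _ => by ring
      _ ≤ (N : ℝ) ^ 4 * (n₀ * K1) := mul_le_mul_of_nonneg_left (hsumV f y) (by positivity)
      _ ≤ C := hcolCs
  · intro hk; apply h
    show (N : ℝ) ^ 4 * k κ f = 0
    rw [hk, mul_zero]

end Reg

end Summit.QuantumFields.YangMills.BalabanUVNodes.N06SectBQLawsKnit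

end
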